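import Literature.Computability.Complexity.SymmetricThresholdPrograms
import HarnessLib

/-!
# Symmetric threshold programs: realisation as a DAG over the threshold basis

Companion of `SymmetricThresholdPrograms.lean` (the programs `SymProg ι Λ` and their semantics
`SymProg.sem`).  Here a program is realised as a `GateDAG` over `tcBasis` with the physical gates
`Node Λ = (Λ × Bool) ⊕ Bool`: for every logical gate `l` a PRE-GATE `(l, false)` — the padded
majority `MAJ_{2(n+1)}` over a constant `false`, the `n` sources of `l` and a threshold padding
(Anderson–Dawar 2017, §3: counting by threshold gates) — and a unary POST-GATE `(l, true)` (a
negation for `nor`, the identity `∧₁` otherwise), plus the two constants `∧₀ = true`, `∨₀ = false`.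

* `SymProg.toDAG o` — the realisation with output the physical wire of the logical wire `o`;
  `fn_mem_tcBasis`, `compile_toDAG_size` (`2·|Λ| + 2` gates);
* `SymProg.val_post` — the post-gate of `l` carries `P.sem x l`; `evalOut_toDAG`,
  `compile_toDAG_eval` — the compiled straight-line circuit computes the semantics at `o`.

## References
* M. Anderson, A. Dawar, *On symmetric circuits and fixed-point logics*, Theory Comput. Syst. 60
  (2017), §3 [AndersonDawar2016].
* H. Vollmer, *Introduction to Circuit Complexity*, Springer 1999, §1.1, Def. 1.9 (threshold and
  majority gates) [Vollmer1999].
-/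

namespace Literature.Computability.Complexity

open Finset

namespace SymProg

variable {ι Λ : Type*} (P : SymProg ι Λ)

/-! ### Realisation as a DAG over the threshold basis -/

section DAG

/-- The PHYSICAL gates: a pre-gate `(l, false)` and a post-gate `(l, true)` for every logical gate,
and the two constants `Sum.inr b`. [folklore] -/
abbrev Node (Λ : Type*) := (Λ × Bool) ⊕ Bool

/-- The physical wires. [folklore] -/
abbrev Wire (ι Λ : Type*) := ι ⊕ Node Λ

/-- The wire of the constant `b`. [folklore] -/
def cst (b : Bool) : Wire ι Λ := Sum.inr (Sum.inr b)

/-- The wire of the pre-gate of `l`. [folklore] -/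
def preW (l : Λ) : Wire ι Λ := Sum.inr (Sum.inl (l, false))

/-- The physical wire of a logical wire: inputs are inputs, a logical gate is its post-gate. [folklore] -/
def wmap : ι ⊕ Λ → Wire ι Λ := Sum.map id fun l => Sum.inl (l, true)

/-- `wmap` on inputs. [folklore] -/
@[simp] theorem wmap_inl (i : ι) : (wmap (Sum.inl i) : Wire ι Λ) = Sum.inl i := rfl

/-- `wmap` on logical gates. [folklore] -/
@[simp] theorem wmap_inr (l : Λ) : (wmap (Sum.inr l) : Wire ι Λ) = Sum.inr (Sum.inl (l, true)) := rfl

/-- `wmap` is injective. [folklore] -/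
theorem wmap_injective : Function.Injective (wmap : ι ⊕ Λ → Wire ι Λ) := by
  rintro (i | l) (i' | l') h
  · cases h; rfl
  · cases h
  · cases h
  · simp only [wmap_inr, Sum.inr.injEq, Sum.inl.injEq, Prod.mk.injEq, and_true] at h
    rw [h]

/-- An enumeration of the source wires of `l` (as physical wires). [folklore] -/
noncomputable def enum (l : Λ) : Fin (P.srcs l).card → Wire ι Λ :=
  fun i => wmap ((P.srcs l).equivFin.symm i : ι ⊕ Λ)

/-- The enumeration is injective. [folklore] -/
theorem enum_injective (l : Λ) : Function.Injective (P.enum l) := by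
  intro i j h
  have := Subtype.ext (wmap_injective h)
  exact (P.srcs l).equivFin.symm.injective this

/-- The range of the enumeration. [folklore] -/
theorem mem_range_enum {l : Λ} {u : Wire ι Λ} :
    u ∈ Set.range (P.enum l) ↔ ∃ w ∈ P.srcs l, wmap w = u := by
  constructor
  · rintro ⟨i, rfl⟩
    exact ⟨_, ((P.srcs l).equivFin.symm i).2, rfl⟩
  · rintro ⟨w, hw, rfl⟩
    exact ⟨(P.srcs l).equivFin ⟨w, hw⟩, by simp [enum]⟩

/-- The padding block of a threshold-`t` counter of width `n + 1`: `n + 1 - t` constant-true wires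
followed by constant-false ones. [cite: AndersonDawar2016, §3 (counting by threshold gates)] -/
def pad (n t : ℕ) : Fin (n + 1) → Wire ι Λ :=
  fun j => if (j : ℕ) + t < n + 1 then cst true else cst false

/-- The arguments of the pre-gate of `l`: a constant `false`, the sources, the padding. [folklore] -/
noncomputable def preArgs (l : Λ) : Fin (((P.srcs l).card + 1) + ((P.srcs l).card + 1)) → Wire ι Λ :=
  Fin.append (Fin.cons (cst false) (P.enum l)) (pad (P.srcs l).card ((P.kind l).thr (P.srcs l).card))

/-- The post-gate of a kind: unary, a negation for `nor` and the identity otherwise. [folklore] -/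
def postFn (κ : Kind) : GateFn := ⟨1, fun v => if κ.neg then !(v 0) else v 0⟩

/-- The post-gate is the basis gate `¬` resp. `∧₁`. [folklore] -/
theorem postFn_eq (κ : Kind) : postFn κ = if κ.neg then GateFn.not else GateFn.and 1 := by
  unfold postFn GateFn.not GateFn.and
  cases κ.neg
  · simp only [Bool.false_eq_true, if_false]
    congr 1
    funext v
    rw [Bool.eq_iff_iff, decide_eq_true_iff, Fin.forall_fin_one]
  · simp

/-- The gate functions of the physical gates: padded majorities, post-gates, constants. [folklore] -/
noncomputable def fn : Node Λ → GateFn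
  | Sum.inl (l, false) => GateFn.maj (((P.srcs l).card + 1) + ((P.srcs l).card + 1))
  | Sum.inl (l, true) => postFn (P.kind l)
  | Sum.inr true => GateFn.and 0
  | Sum.inr false => GateFn.or 0

/-- The argument wires of the physical gates. [folklore] -/
noncomputable def args : (ν : Node Λ) → Fin (P.fn ν).1 → Wire ι Λ
  | Sum.inl (l, false) => P.preArgs l
  | Sum.inl (l, true) => fun _ => preW l
  | Sum.inr true => Fin.elim0
  | Sum.inr false => Fin.elim0

/-- A height function increasing along the wires. [folklore] -/
def height : Node Λ → ℕ
  | Sum.inl (l, false) => 2 * P.rank l + 1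
  | Sum.inl (l, true) => 2 * P.rank l + 2
  | Sum.inr _ => 0

/-- The padding wires are constants. [folklore] -/
theorem pad_eq_cst (n t : ℕ) (j : Fin (n + 1)) : ∃ b, (pad n t j : Wire ι Λ) = cst b := by
  unfold pad; split_ifs
  · exact ⟨true, rfl⟩
  · exact ⟨false, rfl⟩

/-- Gate arguments have smaller height. [folklore] -/
theorem height_lt_of_args (ν : Node Λ) (a : Fin (P.fn ν).1) (μ : Node Λ)
    (h : P.args ν a = Sum.inr μ) : P.height μ < P.height ν := by
  match ν, a, h with
  | Sum.inl (l, false), a, h =>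
    change P.preArgs l a = Sum.inr μ at h
    unfold preArgs at h
    induction a using Fin.addCases with
    | left i =>
      rw [Fin.append_left] at h
      refine Fin.cases ?_ (fun i => ?_) i h
      · intro h
        simp only [Fin.cons_zero, cst, Sum.inr.injEq] at h
        subst h; simp [height]
      · intro h
        simp only [Fin.cons_succ, enum] at h
        rcases hw : ((P.srcs l).equivFin.symm i : ι ⊕ Λ) with i' | l'
        · rw [hw] at h; exact absurd h Sum.inl_ne_inr
        · rw [hw, wmap_inr, Sum.inr.injEq] at h
          subst h
          have hmem : Sum.inr l' ∈ P.srcs l := by rw [← hw]; exact ((P.srcs l).equivFin.symm i).2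
          have := P.rank_lt l l' hmem
          simp only [height]; omega
    | right j =>
      rw [Fin.append_right] at h
      obtain ⟨b, hb⟩ := pad_eq_cst (ι := ι) (Λ := Λ) (P.srcs l).card ((P.kind l).thr (P.srcs l).card) j
      rw [hb, cst, Sum.inr.injEq] at h
      subst h; simp [height]
  | Sum.inl (l, true), a, h =>
    change preW l = Sum.inr μ at h
    rw [preW, Sum.inr.injEq] at h
    subst h; simp [height]
  | Sum.inr true, a, _ => exact a.elim0
  | Sum.inr false, a, _ => exact a.elim0

/-- **The realisation of the program** as a DAG over the threshold basis, with output the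
physical wire of the logical wire `o`. [cite: AndersonDawar2016, Def. 4] -/
noncomputable def toDAG (o : ι ⊕ Λ) : GateDAG ι (Node Λ) where
  fn := P.fn
  args := P.args
  out := wmap o
  wf := Subrelation.wf (fun {μ ν} h => by obtain ⟨a, ha⟩ := h; exact P.height_lt_of_args ν a μ ha)
    (InvImage.wf P.height Nat.lt_wfRel.wf)

/-- Every physical gate is a threshold-basis gate. [cite: Vollmer1999, §1.1] -/
theorem fn_mem_tcBasis (ν : Node Λ) : P.fn ν ∈ tcBasis := by
  match ν with
  | Sum.inl (l, false) => exact Set.mem_union_right _ (Set.mem_iUnion.2 ⟨_, rfl⟩)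
  | Sum.inl (l, true) =>
    show postFn (P.kind l) ∈ tcBasis
    rw [postFn_eq]; split
    · exact Set.mem_union_left _ (Set.mem_union_left _ rfl)
    · exact Set.mem_union_left _ (Set.mem_union_right _ (Set.mem_iUnion.2 ⟨1, Or.inl rfl⟩))
  | Sum.inr true => exact Set.mem_union_left _ (Set.mem_union_right _ (Set.mem_iUnion.2 ⟨0, Or.inl rfl⟩))
  | Sum.inr false => exact Set.mem_union_left _ (Set.mem_union_right _ (Set.mem_iUnion.2 ⟨0, Or.inr rfl⟩))

/-- The realisation is over the threshold basis. [folklore] -/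
theorem compile_toDAG_isOver [Fintype Λ] (o : ι ⊕ Λ) : ((P.toDAG o).compile).IsOver tcBasis :=
  (P.toDAG o).compile_isOver P.fn_mem_tcBasis

/-- The number of physical gates. [folklore] -/
theorem card_node [Fintype Λ] : Fintype.card (Node Λ) = 2 * Fintype.card Λ + 2 := by
  simp only [Fintype.card_sum, Fintype.card_prod, Fintype.card_bool]; ring

/-- **Size of the realisation**: `2·|Λ| + 2` gates. [folklore] -/
theorem compile_toDAG_size [Fintype Λ] (o : ι ⊕ Λ) :
    (P.toDAG o).compile.size = 2 * Fintype.card Λ + 2 := by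
  rw [Circuit.size, GateDAG.compile_gates_length, card_node]

end DAG

/-! ### The realisation computes the semantics -/

section Value

variable (o : ι ⊕ Λ) (x : ι → Bool)

/-- The number of true padding wires. [folklore] -/
theorem numOnes_pad (V : Wire ι Λ → Bool) (hF : V (cst false) = false) (hT : V (cst true) = true)
    (n t : ℕ) : GateFn.numOnes (fun j => V (pad n t j)) = n + 1 - t := by
  have heq : (fun j => V (pad n t j)) = fun j : Fin (n + 1) => decide ((j : ℕ) + t < n + 1) := by
    funext j; unfold pad; split_ifs with h <;> simp [h, hF, hT]
  rw [heq]
  unfold GateFn.numOnes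
  have hset : (univ.filter fun j : Fin (n + 1) => decide ((j : ℕ) + t < n + 1) = true) =
      univ.image (Fin.castLE (Nat.sub_le (n + 1) t) : Fin (n + 1 - t) → Fin (n + 1)) := by
    ext j
    simp only [mem_filter, mem_univ, true_and, mem_image, decide_eq_true_eq]
    constructor
    · intro hj; exact ⟨⟨j, by omega⟩, Fin.ext rfl⟩
    · rintro ⟨j', rfl⟩; have := j'.2; simp only [Fin.val_castLE]; omega
  rw [hset, Finset.card_image_of_injective _ (Fin.castLE_injective _), card_univ, Fintype.card_fin]

/-- **The padded counter**: the majority gate `MAJ_{2(n+1)}` over `(ff, f₀, …, f_{n-1})` and the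
threshold-`t` padding fires iff at least `t` of the wires `fᵢ` are true.
[cite: AndersonDawar2016, §3 (counting by threshold gates)] -/
theorem maj_pad_eq (V : Wire ι Λ → Bool) (hF : V (cst false) = false) (hT : V (cst true) = true)
    {n t : ℕ} (f : Fin n → Wire ι Λ) :
    (GateFn.maj ((n + 1) + (n + 1))).2 (fun a => V (Fin.append (Fin.cons (cst false) f) (pad n t) a)) =
      decide (t ≤ (univ.filter fun i => V (f i) = true).card) := by
  show decide ((n + 1) + (n + 1) ≤ 2 * GateFn.numOnes
    (fun a : Fin ((n + 1) + (n + 1)) => V (Fin.append (Fin.cons (cst false) f) (pad n t) a))) = _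
  have happ : (fun a : Fin ((n + 1) + (n + 1)) => V (Fin.append (Fin.cons (cst false) f) (pad n t) a)) =
      Fin.append (Fin.cons false fun i => V (f i)) (fun j => V (pad n t j)) := by
    funext a
    induction a using Fin.addCases with
    | left i =>
      rw [Fin.append_left, Fin.append_left]
      refine Fin.cases ?_ (fun i => ?_) i
      · simp [hF]
      · simp
    | right j => rw [Fin.append_right, Fin.append_right]
  -- `numOnes` of the concatenation (cf. `LabelledArithCircuit.numOnes_append`, not imported)
  have happend : ∀ {n₁ n₂ : ℕ} (a : Fin n₁ → Bool) (b : Fin n₂ → Bool),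
      GateFn.numOnes (Fin.append a b) = GateFn.numOnes a + GateFn.numOnes b := by
    intro n₁ n₂ a b
    unfold GateFn.numOnes
    rw [Finset.card_filter, Finset.card_filter, Finset.card_filter, Fin.sum_univ_add]
    simp only [Fin.append_left, Fin.append_right]
  have hcons : ∀ {n : ℕ} (a : Fin n → Bool),
      GateFn.numOnes (Fin.cons false a : Fin (n + 1) → Bool) = GateFn.numOnes a := by
    intro n a
    unfold GateFn.numOnes
    rw [Finset.card_filter, Finset.card_filter, Fin.sum_univ_succ]
    simp
  rw [happ, happend, hcons, numOnes_pad V hF hT]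
  have hc : GateFn.numOnes (fun i => V (f i)) = (univ.filter fun i => V (f i) = true).card := rfl
  rw [hc]
  have hle : (univ.filter fun i => V (f i) = true).card ≤ n :=
    (Finset.card_filter_le _ _).trans (by rw [card_univ, Fintype.card_fin])
  rw [Bool.eq_iff_iff, decide_eq_true_iff, decide_eq_true_iff]
  omega

/-- The constants have the right values. [folklore] -/
theorem val_cst (b : Bool) : (P.toDAG o).val x (Sum.inr b) = b := by
  rw [GateDAG.val_eq]
  cases b
  · show decide (∃ a : Fin 0, GateDAG.wire x ((P.toDAG o).val x) (Fin.elim0 a) = true) = false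
    exact decide_eq_false fun ⟨a, _⟩ => a.elim0
  · show decide (∀ a : Fin 0, GateDAG.wire x ((P.toDAG o).val x) (Fin.elim0 a) = true) = true
    exact decide_eq_true fun a => a.elim0

/-- Counting the true sources along the enumeration. [folklore] -/
theorem card_filter_enum (V : Wire ι Λ → Bool) (l : Λ) :
    (univ.filter fun i => V (P.enum l i) = true).card =
      ((P.srcs l).filter fun w => V (wmap w) = true).card := by
  refine Finset.card_bij (fun i _ => (((P.srcs l).equivFin.symm i : P.srcs l) : ι ⊕ Λ)) ?_ ?_ ?_
  · intro i hi
    rw [mem_filter] at hi ⊢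
    exact ⟨((P.srcs l).equivFin.symm i).2, hi.2⟩
  · intro i₁ _ i₂ _ h
    exact (P.srcs l).equivFin.symm.injective (Subtype.ext h)
  · intro w hw
    rw [mem_filter] at hw
    refine ⟨(P.srcs l).equivFin ⟨w, hw.1⟩, ?_, by simp⟩
    rw [mem_filter]
    refine ⟨mem_univ _, ?_⟩
    simpa [enum] using hw.2

/-- **The post-gate of `l` computes the semantics of `l`** (and the pre-gate its threshold test). [folklore] -/
theorem val_post (l : Λ) : (P.toDAG o).val x (Sum.inl (l, true)) = P.sem x l := by
  induction hr : P.rank l using Nat.strong_induction_on generalizing l with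
  | _ r ih =>
    -- the values of the source wires
    have hsrc : ∀ w ∈ P.srcs l, GateDAG.wire x ((P.toDAG o).val x) (wmap w) = wval x (P.sem x) w := by
      intro w hw
      cases w with
      | inl i => rfl
      | inr l' => exact ih (P.rank l') (hr ▸ P.rank_lt l l' hw) l' rfl
    -- the pre-gate
    have hpre : (P.toDAG o).val x (Sum.inl (l, false)) =
        decide ((P.kind l).thr (P.srcs l).card ≤ P.cnt x (P.sem x) l) := by
      rw [GateDAG.val_eq]
      show (GateFn.maj _).2 (fun a => GateDAG.wire x ((P.toDAG o).val x) (P.preArgs l a)) = _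
      unfold preArgs
      rw [maj_pad_eq _ (P.val_cst o x false) (P.val_cst o x true), P.card_filter_enum]
      have hcnt : ((P.srcs l).filter fun w =>
          GateDAG.wire x ((P.toDAG o).val x) (wmap w) = true).card = P.cnt x (P.sem x) l := by
        unfold cnt
        exact congrArg Finset.card
          (Finset.filter_congr fun w hw => Iff.of_eq (congrArg (· = true) (hsrc w hw)))
      rw [hcnt]
    -- the post-gate
    rw [GateDAG.val_eq]
    show (if (P.kind l).neg then !(GateDAG.wire x ((P.toDAG o).val x) (preW l))
      else GateDAG.wire x ((P.toDAG o).val x) (preW l)) = _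
    change (if (P.kind l).neg then !((P.toDAG o).val x (Sum.inl (l, false)))
      else (P.toDAG o).val x (Sum.inl (l, false))) = _
    rw [hpre, P.sem_eq_dec x l, Kind.dec_eq]

/-- Physical wires carry the values of logical wires. [folklore] -/
theorem wire_wmap (w : ι ⊕ Λ) : GateDAG.wire x ((P.toDAG o).val x) (wmap w) = wval x (P.sem x) w := by
  cases w with
  | inl i => rfl
  | inr l => exact P.val_post o x l

/-- **The realisation computes the semantics at the output wire.** [folklore] -/
theorem evalOut_toDAG : (P.toDAG o).evalOut x = wval x (P.sem x) o := P.wire_wmap o x o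

/-- The compiled straight-line circuit computes the semantics. [folklore] -/
theorem compile_toDAG_eval [Fintype Λ] : (P.toDAG o).compile.eval x = wval x (P.sem x) o := by
  rw [GateDAG.compile_eval, evalOut_toDAG]

end Value

end SymProg

end Literature.Computability.Complexity
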